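import Summits.SmoothPoincare4.SmoothPoincare4.Theorems.CylinderEntropyCylinderRungTwoTiltExcess
import Summits.SmoothPoincare4.SmoothPoincare4.Theorems.CylinderEntropyCylinderRungTwoHorizontalOfTiltExcessZero
import Summits.SmoothPoincare4.SmoothPoincare4.Theorems.CylinderEntropyCylinderRungTwoHeightConstOfHorizontal
import Summits.SmoothPoincare4.SmoothPoincare4.Theorems.CylinderEntropyCylinderRungTwoSliceOfConstantHeight
import HarnessLib

/-!
# Route `CylinderEntropy`, crux `CylinderRungTwo` (stmt-SmoothPoincare4-7631), line `killing-flux`: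
# ONLY SLICES ARE CLOSED CONNECTED MINIMAL CROSS-SECTIONS OF `N = S⁴ × ℝ`
# (registered helper `helper_minimalIsSlice`, rigidity layer R2-F)

Let `N = {z ∈ ℝ⁶ | ∑_{i<5} zᵢ² = 1} = S⁴ × ℝ`, whose slices `S⁴ × {c}` are the images of the slice
embeddings `sliceMap c : S⁴ → ℝ⁶` (`Literature.Geometry.Manifold.CylinderSlice`). Let
`ι : M⁴ → N ⊂ ℝ⁶` be a smooth embedding of a closed connected `4`-manifold, with smooth unit normal
`ν` tangent to `N` (`∑_{i<5} νᵢ zᵢ = 0`) and mean curvature `H` (tree `meanCurvature` of `(ι, ν)` in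
`ℝ⁶`). If `H ≡ 0`, then `ι(M)` is a whole slice: `range ι = range (sliceMap c)` for some `c`
(and `M ≃ₘ S⁴`).

Proof: a four-line composition of landed theorems of this line.
1. The tilt-excess identity `∫_M (1 - ν₅²) dμ_g = ∫_M H z₅ ν₅ dμ_g`
   (`tiltExcess_eq_integral_meanCurvature_mul`, `…TiltExcess.lean`) with `H ≡ 0` gives
   `∫_M (1 - ν₅²) dμ_g = 0` (`tiltExcess_eq_zero_of_meanCurvature_eq_zero`).
2. Vanishing tilt excess forces horizontality `ν₅² ≡ 1`
   (`helper_horizontalOfTiltExcessZero`, `…HorizontalOfTiltExcessZero.lean`).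
3. A connected horizontal cross-section has constant height `(ι x)₅ = c`
   (`helper_heightConstOfHorizontal`, `…HeightConstOfHorizontal.lean`); `M` is nonempty, being
   connected, so `c := (ι x₀)₅` works (`exists_height_const_of_meanCurvature_eq_zero`).
4. An embedded closed connected cross-section of constant height `c` is the whole slice
   `S⁴ × {c}` and `M ≃ₘ S⁴` (`helper_sliceOfConstantHeight`, `…SliceOfConstantHeight.lean`):
   `range_eq_sliceMap_and_diffeo_of_meanCurvature_eq_zero`, `helper_minimalIsSlice`.

The registered helpers of steps 2–4 quantify over `M : Type`, so the lemmas from step 3 on are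
stated over `Type` as well (as is the registered signature).

Everything here is PROVED (no `sorry`, no new definitions, no named facts).

References: R. S. Hamilton, Comm. Anal. Geom. 1 (1993) 127–137, §4 (first variation along the
parallel field `z₅ e₅`; the slices `S⁴ × {c}` as the model closed hypersurfaces of `S⁴ × ℝ`);
M. W. Hirsch, *Differential Topology* (1976), Ch. 1 §3 Thm. 3.1.
-/

-- the prescribed namespace `Summit.SmoothPoincare4.SmoothPoincare4.…` repeats `SmoothPoincare4`
set_option linter.dupNamespace false

noncomputable section

open Set Function MeasureTheory
open scoped Manifold ContDiff Topology BigOperators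

namespace Summit.SmoothPoincare4.SmoothPoincare4.Cruxes.CylinderRungTwo.KillingFlux

open Literature.Geometry.Riemannian Literature.Geometry.Lorentzian
  Literature.Geometry.Lorentzian.PseudoRiemannianMetric
open Literature.Geometry.Manifold.CylinderSlice (sliceMap)

/-! ## Minimal cross-sections have vanishing tilt excess -/

/-- **A closed minimal cross-section has vanishing tilt excess.** For a closed immersed
cross-section `f : M⁴ → N = S⁴ × ℝ ⊂ ℝ⁶` with smooth unit normal `ν` tangent to `N` and mean
curvature `H ≡ 0`: `∫_M (1 - ν₅²) dμ_g = 0`, by the tilt-excess identity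
`∫_M (1 - ν₅²) dμ_g = ∫_M H z₅ ν₅ dμ_g` (`tiltExcess_eq_integral_meanCurvature_mul`) whose right
integrand vanishes pointwise. [cite: Hamilton1993, §4] -/
theorem tiltExcess_eq_zero_of_meanCurvature_eq_zero {M : Type*} [TopologicalSpace M]
    [ChartedSpace (EuclideanSpace ℝ (Fin 4)) M] [IsManifold (𝓡 4) ∞ M] [CompactSpace M]
    [T2Space M] [MeasurableSpace M] [BorelSpace M] {f νf : M → EuclideanSpace ℝ (Fin 6)}
    (hf : (euclideanMetric (EuclideanSpace ℝ (Fin 6))).IsSpacelikeImmersion (𝓡 4) f)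
    (hν : ContMDiff (𝓡 4) 𝓘(ℝ, EuclideanSpace ℝ (Fin 6)) ∞ νf)
    (hun : (euclideanMetric (EuclideanSpace ℝ (Fin 6))).IsUnitNormal (𝓡 4) f νf 1)
    (hN : ∀ x, ∑ i : Fin 5, f x (Fin.castSucc i) ^ 2 = 1)
    (hνN : ∀ x, ∑ i : Fin 5, νf x (Fin.castSucc i) * f x (Fin.castSucc i) = 0)
    (hH : ∀ x, (euclideanMetric (EuclideanSpace ℝ (Fin 6))).meanCurvature f
      contMDiff_pullbackBilin_holds hf νf x = 0) :
    ∫ w, (1 - νf w 5 ^ 2) ∂riemannianMeasure ((euclideanMetric (EuclideanSpace ℝ (Fin 6))).inducedRiemannianMetric f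
        contMDiff_pullbackBilin_holds hf) = 0 := by
  rw [tiltExcess_eq_integral_meanCurvature_mul hf hν hun hN hνN]
  simp only [hH, zero_mul, integral_zero]

/-! ## Minimal connected cross-sections have constant height -/

/-- **A closed connected minimal cross-section is horizontal and has constant height.** For a
closed connected immersed cross-section `f : M⁴ → N = S⁴ × ℝ` with smooth unit normal `ν` tangent
to `N` and `H ≡ 0`: `ν₅² ≡ 1` and the height `(f x)₅` is a constant `c`. The tilt excess vanishes
(`tiltExcess_eq_zero_of_meanCurvature_eq_zero`), which forces horizontality
(`helper_horizontalOfTiltExcessZero`), and a connected horizontal cross-section has constant height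
(`helper_heightConstOfHorizontal`); `M ≠ ∅` being connected. [cite: Hamilton1993, §4] -/
theorem exists_height_const_of_meanCurvature_eq_zero {M : Type} [TopologicalSpace M]
    [ChartedSpace (EuclideanSpace ℝ (Fin 4)) M] [IsManifold (𝓡 4) ∞ M] [CompactSpace M]
    [T2Space M] [MeasurableSpace M] [BorelSpace M] [ConnectedSpace M]
    {f νf : M → EuclideanSpace ℝ (Fin 6)}
    (hf : (euclideanMetric (EuclideanSpace ℝ (Fin 6))).IsSpacelikeImmersion (𝓡 4) f)
    (hν : ContMDiff (𝓡 4) 𝓘(ℝ, EuclideanSpace ℝ (Fin 6)) ∞ νf)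
    (hun : (euclideanMetric (EuclideanSpace ℝ (Fin 6))).IsUnitNormal (𝓡 4) f νf 1)
    (hN : ∀ x, ∑ i : Fin 5, f x (Fin.castSucc i) ^ 2 = 1)
    (hνN : ∀ x, ∑ i : Fin 5, νf x (Fin.castSucc i) * f x (Fin.castSucc i) = 0)
    (hH : ∀ x, (euclideanMetric (EuclideanSpace ℝ (Fin 6))).meanCurvature f
      contMDiff_pullbackBilin_holds hf νf x = 0) :
    (∀ x, νf x 5 ^ 2 = 1) ∧ ∃ c : ℝ, ∀ x, f x 5 = c := by
  -- (1) the tilt excess vanishes, (2) hence `ν₅² ≡ 1`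
  have h5 : ∀ x, νf x 5 ^ 2 = 1 :=
    helper_horizontalOfTiltExcessZero M f νf hf hν.continuous hun
      (tiltExcess_eq_zero_of_meanCurvature_eq_zero hf hν hun hN hνN hH)
  -- (3) hence the height is constant; `M` is nonempty (connected)
  exact ⟨h5, f (Classical.arbitrary M) 5, fun x =>
    helper_heightConstOfHorizontal M f νf hf.contMDiff_self hun h5 x (Classical.arbitrary M)⟩

/-! ## Only slices are closed connected minimal cross-sections -/

/-- **Only slices are closed connected embedded minimal cross-sections of `N = S⁴ × ℝ`** (with the
diffeomorphism type). For a smooth embedding `ι : M⁴ → N ⊂ ℝ⁶` of a closed connected `4`-manifold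
with smooth unit normal `ν` tangent to `N` and mean curvature `H ≡ 0`, there is a height `c` with
`(ι x)₅ = c` for all `x`, `range ι = S⁴ × {c} = range (sliceMap c)`, and `M ≃ₘ S⁴`: constant
height by `exists_height_const_of_meanCurvature_eq_zero`, then `helper_sliceOfConstantHeight`.
[cite: Hamilton1993, §4] -/
theorem range_eq_sliceMap_and_diffeo_of_meanCurvature_eq_zero {M : Type} [TopologicalSpace M]
    [T2Space M] [SecondCountableTopology M] [ChartedSpace (EuclideanSpace ℝ (Fin 4)) M]
    [IsManifold (𝓡 4) ∞ M] [CompactSpace M] [ConnectedSpace M] [MeasurableSpace M] [BorelSpace M]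
    {ι ν : M → EuclideanSpace ℝ (Fin 6)} (hι : Manifold.IsSmoothEmbedding (𝓡 4) (𝓡 6) ∞ ι)
    (himm : (euclideanMetric (EuclideanSpace ℝ (Fin 6))).IsSpacelikeImmersion (𝓡 4) ι)
    (hN : ∀ x, ∑ i : Fin 5, ι x (Fin.castSucc i) ^ 2 = 1)
    (hν : ContMDiff (𝓡 4) (𝓡 6) ∞ ν)
    (hun : (euclideanMetric (EuclideanSpace ℝ (Fin 6))).IsUnitNormal (𝓡 4) ι ν 1)
    (hνN : ∀ x, ∑ i : Fin 5, ν x (Fin.castSucc i) * ι x (Fin.castSucc i) = 0)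
    (hH : ∀ x, (euclideanMetric (EuclideanSpace ℝ (Fin 6))).meanCurvature ι
      contMDiff_pullbackBilin_holds himm ν x = 0) :
    ∃ c : ℝ, (∀ x, ι x 5 = c) ∧ Set.range ι = Set.range (sliceMap c) ∧
      Nonempty (M ≃ₘ⟮𝓡 4, 𝓡 4⟯ Metric.sphere (0 : EuclideanSpace ℝ (Fin 5)) 1) := by
  obtain ⟨-, c, hc⟩ := exists_height_const_of_meanCurvature_eq_zero himm hν hun hN hνN hH
  exact ⟨c, hc, helper_sliceOfConstantHeight M ι hι hN c hc⟩

/-- **Registered helper `helper_minimalIsSlice` of line `killing-flux` (rigidity layer R2-F: only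
slices are closed connected minimal cross-sections of `N = S⁴ × ℝ`).** For a smooth embedding
`ι : M⁴ → N ⊂ ℝ⁶` of a closed connected `4`-manifold with smooth unit normal `ν` tangent to `N`
and mean curvature `H ≡ 0` (tree `meanCurvature` of `(ι, ν)`), `range ι` is a slice
`S⁴ × {c} = range (sliceMap c)`: tilt-excess identity with `H ≡ 0` ⟹ tilt excess `0` ⟹ `ν₅² ≡ 1`
⟹ constant height `c` ⟹ whole slice (`range_eq_sliceMap_and_diffeo_of_meanCurvature_eq_zero`).
[cite: Hamilton1993, §4] -/
theorem helper_minimalIsSlice :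
    ∀ (M : Type) [TopologicalSpace M] [T2Space M] [SecondCountableTopology M]
      [ChartedSpace (EuclideanSpace ℝ (Fin 4)) M] [IsManifold (𝓡 4) ∞ M] [CompactSpace M]
      [ConnectedSpace M] [MeasurableSpace M] [BorelSpace M] (ι ν : M → EuclideanSpace ℝ (Fin 6))
      (hι : Manifold.IsSmoothEmbedding (𝓡 4) (𝓡 6) ∞ ι)
      (himm : (Literature.Geometry.Riemannian.euclideanMetric
        (EuclideanSpace ℝ (Fin 6))).IsSpacelikeImmersion (𝓡 4) ι),
      (∀ x, ∑ i : Fin 5, ι x (Fin.castSucc i) ^ 2 = 1) →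
      ContMDiff (𝓡 4) (𝓡 6) ∞ ν →
      (Literature.Geometry.Riemannian.euclideanMetric
        (EuclideanSpace ℝ (Fin 6))).IsUnitNormal (𝓡 4) ι ν 1 →
      (∀ x, ∑ i : Fin 5, ν x (Fin.castSucc i) * ι x (Fin.castSucc i) = 0) →
      (∀ x, (Literature.Geometry.Riemannian.euclideanMetric
        (EuclideanSpace ℝ (Fin 6))).meanCurvature ι
        Literature.Geometry.Lorentzian.PseudoRiemannianMetric.contMDiff_pullbackBilin_holds himm ν x
          = 0) →
      ∃ c : ℝ, Set.range ι = Set.range (Literature.Geometry.Manifold.CylinderSlice.sliceMap c) := by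
  intro M _ _ _ _ _ _ _ _ _ ι ν hι himm hN hν hun hνN hH
  obtain ⟨c, -, hrange, -⟩ :=
    range_eq_sliceMap_and_diffeo_of_meanCurvature_eq_zero hι himm hN hν hun hνN hH
  exact ⟨c, hrange⟩

end Summit.SmoothPoincare4.SmoothPoincare4.Cruxes.CylinderRungTwo.KillingFlux

end
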